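import Mathlib
import Literature.Computability.Complexity.ExtMonotoneGates
import Literature.Computability.Complexity.CliqueApproximatorsWide
import Literature.Computability.Complexity.RossmanMonotoneCliqueProb
import Summits.PneNP.PneNP.Theorems.ConvexRankGatesLinAlgGateBlindDefs

/-!
# Stub `stub_termCollapse` of line `dnf-invariant-wide-gates-see-small-cliques` for crux `LinAlgGateBlind` (stmt-PneNP-10681, route ConvexRankGates)

**Term-gate collapse `Lin ∘ OR ⊆ Lin`.** A PERM gate (`IsPermGate s g`) or a GRANK gate
(`IsGRankGate s g`) of parameter `s`, fed with the small-clique DNFs `⌈A_i⌉ = ⋁_{X ∈ A_i} ⌈X⌉`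
(`acceptsB (A i)`) of families `A_i ⊆ 𝒱(l)` (`smallSets`), is ONE gate of the SAME class and the
SAME parameter `s` whose inputs are the clique ATOMS `⌈X⌉` (`atomB X`), `X ∈ ⋃ A_i` — a term gate
(`IsTermGate`). This is `stub_termCollapse`, the registered stub 1 of the line.

Construction. Index the new inputs by the pairs `(i, X)`, `X ∈ A i` (via `Fintype.equivFin` of
`Σ i, A i`), with projection `π (i, X) = i` and atom `X`. For a graph `x` the old input vector
`v i = ⌈A_i⌉(x)` and the new one `w (i, X) = ⌈X⌉(x)` satisfy the KEY IDENTITY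
`v i = 1 ↔ ∃ a, π a = i ∧ w a = 1` (`acceptsB_eq_true_iff_exists_atom`). Everything else is
proved for an arbitrary rewiring `π : Fin N → Fin n` and inputs `v, w` tied by this identity:

* PERM (`image_rewire_eq`): with `σ'_a := σ_{π a}`, same `τ`, same `d`, the selected generator
  SETS coincide, `{σ'_a : w a = 1} = {σ_i : v i = 1}`, hence so do the generated subgroups.
* GRANK (`le_rank_symbolicMatrix_rewire_iff`): with `K'_a := K_{π a}`, same `F, d, θ, K₀`, the
  generic symbolic matrix of the new gate is the image of the old one under the `F`-algebra map
  `φ : X_i ↦ ∑_{π a = i} Y_a` (`symbolicPolyMatrix_rewire`), so its minors are the `φ`-images of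
  the old minors (`AlgHom.map_det`); and killing the unselected new variables after `φ` is the
  map `φ_w : X_i ↦ ∑_{π a = i, w a = 1} Y_a` after killing the unselected old variables
  (`killVars_comp_rewire`), where `φ_w` is injective on polynomials in the selected old variables
  (left inverse `Y_{a(i)} ↦ X_i` for the least selected `a(i)` over `i`, other `Y ↦ 0`;
  `killVars_eq_zero_of_rewire`). Hence a killed minor vanishes for `w` iff it vanishes for `v`,
  and the generic ranks agree (rank = largest non-vanishing minor,
  `Literature.LinearAlgebra.Matrix.le_rank_iff_exists_det_submatrix_ne_zero`,
  `det_submatrix_symbolicMatrix_eq_zero_iff`), at the SAME dimension `d`.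

References: Alon–Boppana 1987 §3 (the lattice of closed families and clique indicators `⌈X⌉`);
J. Edmonds, *Systems of distinct representatives and linear algebra*, J. Res. NBS 71B (1967) §5
Thm. 1 and §7 (generic rank = largest non-vanishing minor). [folklore]
-/

-- `Summit.PneNP.PneNP.…` duplicates `PneNP` BY DESIGN (single-problem summit).
set_option linter.dupNamespace false

noncomputable section

namespace Summit.PneNP.PneNP.Cruxes.LinAlgGateBlind.DnfInvariantWideGatesSeeSmallCliques

open scoped BigOperators
open Finset Literature.Computability.Complexity Razborov

/-! ### Rewiring a gate along `π : Fin N → Fin n`: the PERM case -/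

section Rewire

variable {n N : ℕ} (π : Fin N → Fin n) {v : Fin n → Bool} {w : Fin N → Bool}

/-- **PERM rewiring.** If `v i = 1 ↔ ∃ a, π a = i ∧ w a = 1`, then repeating the generator `σ_i`
on every new wire `a` over `i` selects the same SET of generators:
`{σ_{π a} : w a = 1} = {σ_i : v i = 1}`. [folklore] -/
theorem image_rewire_eq {α : Type*} (σ : Fin n → α)
    (H : ∀ i, v i = true ↔ ∃ a, π a = i ∧ w a = true) :
    (fun a => σ (π a)) '' {a | w a = true} = σ '' {i | v i = true} := by
  ext τ
  simp only [Set.mem_image, Set.mem_setOf_eq]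
  constructor
  · rintro ⟨a, ha, rfl⟩
    exact ⟨π a, (H (π a)).2 ⟨a, rfl, ha⟩, rfl⟩
  · rintro ⟨i, hi, rfl⟩
    obtain ⟨a, rfl, ha⟩ := (H i).1 hi
    exact ⟨a, ha, rfl⟩

/-! ### Rewiring a gate along `π : Fin N → Fin n`: the GRANK case -/

variable {F : Type*} [Field F]

/-- **The substitution `φ : X_i ↦ ∑_{π a = i} Y_a` turns the generic symbolic matrix of the data
`(K₀, K_i)` into that of the rewired data `(K₀, K_{π a})`**:
`K₀ + ∑_a Y_a K_{π a} = φ (K₀ + ∑_i X_i K_i)` entrywise (regroup the sum over `a` along the fibres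
of `π`). [folklore] -/
theorem symbolicPolyMatrix_rewire (φ : MvPolynomial (Fin n) F →ₐ[F] MvPolynomial (Fin N) F)
    (hφ : ∀ i, φ (MvPolynomial.X i) =
      ∑ a ∈ (univ : Finset (Fin N)) with π a = i, (MvPolynomial.X a : MvPolynomial (Fin N) F))
    {d : ℕ} (K₀ : Matrix (Fin d) (Fin d) F) (K : Fin n → Matrix (Fin d) (Fin d) F) :
    symbolicPolyMatrix K₀ (fun a => K (π a)) = (symbolicPolyMatrix K₀ K).map φ := by
  refine Matrix.ext fun p q => ?_
  simp only [symbolicPolyMatrix, Matrix.map_apply, Matrix.add_apply, Matrix.sum_apply,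
    Matrix.smul_apply, smul_eq_mul, map_add, map_sum, map_mul, MvPolynomial.algHom_C,
    MvPolynomial.algebraMap_eq, hφ, Finset.sum_mul]
  congr 1
  rw [← Finset.sum_fiberwise univ π fun a =>
    (MvPolynomial.X a : MvPolynomial (Fin N) F) * MvPolynomial.C (K (π a) p q)]
  refine Finset.sum_congr rfl fun i _ => ?_
  refine Finset.sum_congr rfl fun a ha => ?_
  rw [(Finset.mem_filter.1 ha).2]

/-- Minors of the rewired generic symbolic matrix are the `φ`-images of the old minors
(`AlgHom.map_det`). [folklore] -/
theorem det_submatrix_symbolicPolyMatrix_rewire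
    (φ : MvPolynomial (Fin n) F →ₐ[F] MvPolynomial (Fin N) F)
    (hφ : ∀ i, φ (MvPolynomial.X i) =
      ∑ a ∈ (univ : Finset (Fin N)) with π a = i, (MvPolynomial.X a : MvPolynomial (Fin N) F))
    {d : ℕ} (K₀ : Matrix (Fin d) (Fin d) F) (K : Fin n → Matrix (Fin d) (Fin d) F)
    {ι : Type*} [Fintype ι] [DecidableEq ι] (r c : ι → Fin d) :
    ((symbolicPolyMatrix K₀ (fun a => K (π a))).submatrix r c).det =
      φ (((symbolicPolyMatrix K₀ K).submatrix r c).det) := by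
  rw [symbolicPolyMatrix_rewire π φ hφ, Matrix.submatrix_map, AlgHom.map_det,
    AlgHom.mapMatrix_apply]

/-- **Killing after substituting = substituting the selected fibres after killing**: if
`v i = 1 ↔ ∃ a, π a = i ∧ w a = 1`, then `kill_w ∘ φ = φ_w ∘ kill_v` on `F[X]`, where
`φ_w : X_i ↦ ∑_{π a = i, w a = 1} Y_a` (an unselected `X_i` has no selected `Y_a` over it).
[folklore] -/
theorem killVars_comp_rewire (φ : MvPolynomial (Fin n) F →ₐ[F] MvPolynomial (Fin N) F)
    (hφ : ∀ i, φ (MvPolynomial.X i) =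
      ∑ a ∈ (univ : Finset (Fin N)) with π a = i, (MvPolynomial.X a : MvPolynomial (Fin N) F))
    (H : ∀ i, v i = true ↔ ∃ a, π a = i ∧ w a = true) :
    (killVars w).comp φ =
      (MvPolynomial.aeval fun i : Fin n =>
          ∑ a ∈ (univ : Finset (Fin N)) with (π a = i ∧ w a = true),
            (MvPolynomial.X a : MvPolynomial (Fin N) F)).comp (killVars v) := by
  refine MvPolynomial.algHom_ext fun i => ?_
  by_cases hv : v i = true
  · simp only [AlgHom.comp_apply, hφ, killVars_X, map_sum, if_pos hv, MvPolynomial.aeval_X]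
    rw [← Finset.sum_filter, Finset.filter_filter]
  · simp only [AlgHom.comp_apply, hφ, killVars_X, map_sum, if_neg hv, map_zero]
    refine Finset.sum_eq_zero fun a ha => if_neg fun hw => hv ?_
    exact (H i).2 ⟨a, (Finset.mem_filter.1 ha).2, hw⟩

/-- **`φ_w` is injective on the polynomials in the selected old variables**: for each selected
`i` pick the least selected new wire `a(i)` over it (it exists by the key identity); the
`F`-algebra map `ψ : Y_{a(i)} ↦ X_i`, other `Y_a ↦ 0` is a left inverse of `φ_w` on the range of
`kill_v`. [folklore] -/
theorem killVars_eq_zero_of_rewire (H : ∀ i, v i = true ↔ ∃ a, π a = i ∧ w a = true)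
    (P : MvPolynomial (Fin n) F)
    (h0 : (MvPolynomial.aeval fun i : Fin n =>
        ∑ a ∈ (univ : Finset (Fin N)) with (π a = i ∧ w a = true),
          (MvPolynomial.X a : MvPolynomial (Fin N) F)) (killVars v P) = 0) :
    killVars v P = 0 := by
  -- the left inverse `ψ`: a new wire `a` is CHOSEN iff it is the least selected wire over `π a`
  have hψ : (MvPolynomial.aeval (R := F) fun a : Fin N =>
      if ((univ : Finset (Fin N)).filter fun b => π b = π a ∧ w b = true).min =
          (a : WithTop (Fin N)) then (MvPolynomial.X (π a) : MvPolynomial (Fin n) F) else 0).comp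
      ((MvPolynomial.aeval fun i : Fin n =>
        ∑ a ∈ (univ : Finset (Fin N)) with (π a = i ∧ w a = true),
          (MvPolynomial.X a : MvPolynomial (Fin N) F)).comp (killVars v)) = killVars v := by
    refine MvPolynomial.algHom_ext fun i => ?_
    by_cases hv : v i = true
    · obtain ⟨a₀, ha₀⟩ := Finset.min_of_nonempty
        (s := (univ : Finset (Fin N)).filter fun b => π b = i ∧ w b = true) (by
          obtain ⟨a, ha, hw⟩ := (H i).1 hv
          exact ⟨a, Finset.mem_filter.2 ⟨Finset.mem_univ _, ha, hw⟩⟩)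
      simp only [AlgHom.comp_apply, killVars_X, if_pos hv, MvPolynomial.aeval_X, map_sum]
      rw [Finset.sum_eq_single_of_mem a₀ (Finset.mem_of_min ha₀)]
      · rw [((Finset.mem_filter.1 (Finset.mem_of_min ha₀)).2).1, ha₀, if_pos rfl]
      · intro b hb hne
        rw [((Finset.mem_filter.1 hb).2).1, ha₀]
        exact if_neg fun h => hne (WithTop.coe_inj.1 h).symm
    · simp only [AlgHom.comp_apply, killVars_X, if_neg hv, map_zero]
  have h1 := DFunLike.congr_fun hψ P
  simp only [AlgHom.comp_apply] at h1
  rw [← h1, h0, map_zero]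

/-- A killed polynomial vanishes for `w` after the substitution `φ` iff it vanishes for `v`.
[folklore] -/
theorem killVars_rewire_eq_zero_iff (φ : MvPolynomial (Fin n) F →ₐ[F] MvPolynomial (Fin N) F)
    (hφ : ∀ i, φ (MvPolynomial.X i) =
      ∑ a ∈ (univ : Finset (Fin N)) with π a = i, (MvPolynomial.X a : MvPolynomial (Fin N) F))
    (H : ∀ i, v i = true ↔ ∃ a, π a = i ∧ w a = true) (P : MvPolynomial (Fin n) F) :
    killVars w (φ P) = 0 ↔ killVars v P = 0 := by
  have h1 := DFunLike.congr_fun (killVars_comp_rewire π φ hφ H) P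
  simp only [AlgHom.comp_apply] at h1
  rw [h1]
  refine ⟨killVars_eq_zero_of_rewire π H P, fun h => ?_⟩
  rw [h, map_zero]

/-- **GRANK rewiring preserves the generic rank threshold at the same dimension.** If
`v i = 1 ↔ ∃ a, π a = i ∧ w a = 1`, then `θ ≤ rank (K₀ + ∑_{w a = 1} Y_a K_{π a})` iff
`θ ≤ rank (K₀ + ∑_{v i = 1} X_i K_i)` (rank is witnessed by a non-zero minor, Edmonds 1967 §5
Thm. 1; the killed minors correspond under `φ`, `φ_w` and the left inverse `ψ`). [folklore] -/
theorem le_rank_symbolicMatrix_rewire_iff (H : ∀ i, v i = true ↔ ∃ a, π a = i ∧ w a = true)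
    {d : ℕ} (K₀ : Matrix (Fin d) (Fin d) F) (K : Fin n → Matrix (Fin d) (Fin d) F) (θ : ℕ) :
    θ ≤ (symbolicMatrix K₀ (fun a => K (π a)) w).rank ↔ θ ≤ (symbolicMatrix K₀ K v).rank := by
  -- the substitution `φ : X_i ↦ ∑_{π a = i} Y_a`
  set φ : MvPolynomial (Fin n) F →ₐ[F] MvPolynomial (Fin N) F :=
    MvPolynomial.aeval fun i : Fin n =>
      ∑ a ∈ (univ : Finset (Fin N)) with π a = i, (MvPolynomial.X a : MvPolynomial (Fin N) F)
  have hφ : ∀ i, φ (MvPolynomial.X i) =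
      ∑ a ∈ (univ : Finset (Fin N)) with π a = i, (MvPolynomial.X a : MvPolynomial (Fin N) F) :=
    fun i => MvPolynomial.aeval_X _ _
  rw [Literature.LinearAlgebra.Matrix.le_rank_iff_exists_det_submatrix_ne_zero,
    Literature.LinearAlgebra.Matrix.le_rank_iff_exists_det_submatrix_ne_zero]
  refine exists_congr fun r => exists_congr fun c => not_congr ?_
  rw [det_submatrix_symbolicMatrix_eq_zero_iff, det_submatrix_symbolicMatrix_eq_zero_iff,
    det_submatrix_symbolicPolyMatrix_rewire π φ hφ K₀ K r c, killVars_rewire_eq_zero_iff π φ hφ H]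

end Rewire

/-! ### Term gates from a rewiring of atoms -/

open Classical in
/-- `⌈X⌉(x) = 1` iff the clique on `X` is present in `x`. [folklore] -/
theorem atomB_eq_true_iff {m : ℕ} (X : Finset (Fin m)) (x : KEdge m → Bool) :
    atomB X x = true ↔ CliquePresent X x :=
  decide_eq_true_iff

open Classical in
/-- `⌈𝒜⌉(x) = 1` iff some `X ∈ 𝒜` spans a clique of `x`. [folklore] -/
theorem acceptsB_eq_true_iff {m : ℕ} (𝒜 : Finset (Finset (Fin m))) (x : KEdge m → Bool) :
    acceptsB 𝒜 x = true ↔ ∃ X ∈ 𝒜, CliquePresent X x :=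
  decide_eq_true_iff

/-- **The key identity.** Index the atoms `X ∈ A i` of all children by `Fin N` through an
equivalence `e`; then `⌈A_i⌉(x) = 1` iff some new wire `a` over `i` has its atom present in `x`.
[folklore] -/
theorem acceptsB_eq_true_iff_exists_atom {m n N : ℕ} (A : Fin n → Finset (Finset (Fin m)))
    (e : (Σ i : Fin n, {X // X ∈ A i}) ≃ Fin N) (x : KEdge m → Bool) (i : Fin n) :
    acceptsB (A i) x = true ↔
      ∃ a : Fin N, (e.symm a).1 = i ∧ atomB ((e.symm a).2 : Finset (Fin m)) x = true := by
  rw [acceptsB_eq_true_iff]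
  constructor
  · rintro ⟨X, hX, hP⟩
    refine ⟨e ⟨i, X, hX⟩, ?_, ?_⟩
    · rw [Equiv.symm_apply_apply]
    · rw [Equiv.symm_apply_apply, atomB_eq_true_iff]
      exact hP
  · rintro ⟨a, rfl, hP⟩
    exact ⟨_, (e.symm a).2.2, (atomB_eq_true_iff _ _).1 hP⟩

open Classical in
/-- **Collapse along a rewiring.** If the atoms `Xat a ∈ 𝒱(l)`, `a < N`, with projection
`π : Fin N → Fin g.1` satisfy the key identity `⌈A_i⌉(x) = 1 ↔ ∃ a, π a = i ∧ ⌈Xat a⌉(x) = 1`,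
then `x ↦ g(⌈A_1⌉(x), …, ⌈A_n⌉(x))` is a term gate of the class of `g` (PERM resp. GRANK, same
parameter `s`) over the atoms `Xat`. [folklore] -/
theorem isTermGate_of_rewire (m s l : ℕ) (g : GateFn) (A : Fin g.1 → Finset (Finset (Fin m)))
    (N : ℕ) (π : Fin N → Fin g.1) (Xat : Fin N → Finset (Fin m))
    (hX : ∀ a, Xat a ∈ smallSets (Fin m) l)
    (hkey : ∀ (x : KEdge m → Bool) (i : Fin g.1),
      acceptsB (A i) x = true ↔ ∃ a, π a = i ∧ atomB (Xat a) x = true) :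
    (IsPermGate s g → IsTermGate m (IsPermGate s) l fun x => g.2 fun i => acceptsB (A i) x) ∧
      (IsGRankGate s g →
        IsTermGate m (IsGRankGate s) l fun x => g.2 fun i => acceptsB (A i) x) := by
  constructor
  · rintro ⟨d, hd, σ, τ, hg⟩
    refine ⟨⟨N, fun w => decide (τ ∈ Subgroup.closure ((fun a => σ (π a)) '' {a | w a = true}))⟩,
      ⟨d, hd, fun a => σ (π a), τ, fun w => decide_eq_true_iff⟩, Xat, hX, fun x => ?_⟩
    change g.2 (fun i => acceptsB (A i) x) =
      decide (τ ∈ Subgroup.closure ((fun a => σ (π a)) '' {a | atomB (Xat a) x = true}))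
    rw [Bool.eq_iff_iff, hg, decide_eq_true_iff, image_rewire_eq π σ (hkey x)]
  · rintro ⟨F, _, d, θ, hd, K₀, K, hg⟩
    refine ⟨⟨N, fun w => decide (θ ≤ (symbolicMatrix K₀ (fun a => K (π a)) w).rank)⟩,
      ⟨F, inferInstance, d, θ, hd, K₀, fun a => K (π a), fun w => decide_eq_true_iff⟩, Xat, hX,
      fun x => ?_⟩
    change g.2 (fun i => acceptsB (A i) x) =
      decide (θ ≤ (symbolicMatrix K₀ (fun a => K (π a)) fun a => atomB (Xat a) x).rank)
    rw [Bool.eq_iff_iff, hg, decide_eq_true_iff]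
    exact (le_rank_symbolicMatrix_rewire_iff π (hkey x) K₀ K θ).symm

/-! ### The registered stub -/

/-- **Stub 1 — term-gate collapse `Lin ∘ OR ⊆ Lin`.** A PERM or GRANK gate `g` of parameter `s`
fed with the small-clique DNFs `⌈A_i⌉`, `A_i ⊆ 𝒱(l)`, is ONE gate of the same class and the same
parameter `s` over clique atoms `⌈X⌉`, `X ∈ ⋃ A_i`. PERM: repeat the generator `σ_i` on every new
wire `(i, X)`, same `τ`, same `d`; GRANK: `K'_{(i,X)} := K_i`, same `F, d, θ, K₀` (the
substitution `X_i ↦ ∑_{X ∈ A_i} Y_{(i,X)}` preserves the generic rank of every killed symbolic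
matrix). [folklore] -/
theorem stub_termCollapse : ∀ (m s l : ℕ) (g : GateFn) (A : Fin g.1 → Finset (Finset (Fin m))), (∀ i, A i ⊆ smallSets (Fin m) l) → (IsPermGate s g → IsTermGate m (IsPermGate s) l fun x => g.2 fun i => acceptsB (A i) x) ∧ (IsGRankGate s g → IsTermGate m (IsGRankGate s) l fun x => g.2 fun i => acceptsB (A i) x) := by
  intro m s l g A hA
  -- index the atoms `X ∈ A i` of all children by `Fin N`, `N = ∑ i, #(A i)`
  set e := Fintype.equivFin (Σ i : Fin g.1, {X // X ∈ A i})
  exact isTermGate_of_rewire m s l g A _ (fun a => (e.symm a).1)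
    (fun a => ((e.symm a).2 : Finset (Fin m))) (fun a => hA _ (e.symm a).2.2)
    (acceptsB_eq_true_iff_exists_atom A e)

end Summit.PneNP.PneNP.Cruxes.LinAlgGateBlind.DnfInvariantWideGatesSeeSmallCliques

end
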